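import Mathlib
import HarnessLib
import Literature.Analysis.FluidPDE.HalfLineOUViscosity
import Summits.NavierStokesRegularity.NavierStokesRegularity.Theorems.UnthreadedDoorNetFluxDefs
import Summits.NavierStokesRegularity.NavierStokesRegularity.Theorems.UnthreadedDoorNetFluxViscosityDefs
import Summits.NavierStokesRegularity.NavierStokesRegularity.Theorems.UnthreadedDoorNetFluxViscosityStep

/-!
# NF-4ᵛ of the netflux line (crux `PoloidalLiouville`, stmt-NavierStokesRegularity-1222, WALL W1): the window-decay composition
# `OneSidedNetFluxLaw → OscLeVorticity → NearCentreFlux → NetFluxWindowDecay` — BY NAME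

Route `UnthreadedDoor`, crux idea «netflux-typei-gap» line v5 = VISCOSITY (planner ns-idea-14 g3; critic ns-wall-crit-1 V14
PASS-WITH-PRICE), registered stub `stub_windowDecay_viscosity : OneSidedNetFluxLaw → OscLeVorticity → NearCentreFlux → NetFluxWindowDecay`
of `Cruxes/PoloidalLiouville/Lines/netflux_typei_gap.lean` (bcd4955f0879).  ARM A `pub/ns-exp-scalarLiouville` g3.

`NetFlux.netFluxWindowDecay_of_laws` proves it for the Theorems-side twins (`UnthreadedDoorNetFluxDefs` p660450,
`UnthreadedDoorNetFluxViscosityDefs` p667720; bodies verbatim), following the line's derivation (WD):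
(1) a-priori `0 ≤ w(t,r) = netFlux (T t) x₀ r ≤ π C₁ r/(−t)` from NF-0 `OscLeVorticity` and `‖ω‖ ≤ C₁/(−t)`;
(2) `U(s,ρ) := ∫₀^{ρ e^{−s/2}} w(−e^{−s}, r) dr` is continuous on `[s₁,∞) × [0,∞)` (`continuousOn_window_primitive`, p668007),
    vanishes at `ρ = 0` and is `≤ (π/2) C₁ (1+ρ)³`;
(3) the viscosity inequality `φₛ ≤ φ₂ + (C − ρ/2) φ₁` at joint touching points (`viscosity_inequality_window`, from (L) + (NC));
(4) `HalfLineOU.halfLineOU_decay_viscosity` (NF-3ᵛ, p663208) BY NAME, then back to `(t,R)`: `e^{−λ(s−s₁)} = (t/t₁)^λ`.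

WHAT THIS IS NOT: no NS-regularity statement is touched; (L) `OneSidedNetFluxLaw` (NF-1cᵛ, from the hinges NF-1a/NF-1bᵛ) and (NC)
`NearCentreFlux` (NF-6) remain stubs of the line; `PoloidalLiouville` (1222), W1 and the line's rung target stay OPEN.
`--supports stmt-NavierStokesRegularity-1222 --as helper`.  [folklore]
-/

-- the summit and its single problem share the name (D-0017 nested layout)
set_option linter.dupNamespace false

noncomputable section

open Set Function Filter Topology MeasureTheory intervalIntegral
open scoped RealInnerProductSpace

namespace Summit.NavierStokesRegularity.NavierStokesRegularity.Theorems.PoloidalLiouville.NetFlux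

open Literature.Analysis.FluidPDE

/-- A sphere of positive radius avoids its centre. -/
theorem sphere_subset_compl_center (x₀ : E3) {r : ℝ} (hr : 0 < r) : Metric.sphere x₀ r ⊆ ({x₀}ᶜ : Set E3) := by
  intro x hx h
  rw [mem_singleton_iff] at h
  rw [h, Metric.mem_sphere, dist_self] at hx
  exact hr.ne' hx.symm

/-- `0 ≤ osc_{S_r(x₀)} f` for `r > 0` when `f` is continuous off the centre (the image of the sphere is compact and nonempty). -/
theorem sphOsc_nonneg_offCentre {f : E3 → ℝ} {x₀ : E3} (hf : ContinuousOn f {x₀}ᶜ) {r : ℝ} (hr : 0 < r) :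
    0 ≤ sphOsc f x₀ r := by
  unfold sphOsc sphSup sphInf
  have hK : IsCompact (f '' Metric.sphere x₀ r) :=
    (isCompact_sphere x₀ r).image_of_continuousOn (hf.mono (sphere_subset_compl_center x₀ hr))
  obtain ⟨y, hy⟩ : (f '' Metric.sphere x₀ r).Nonempty := ((NormedSpace.sphere_nonempty).2 hr.le).image f
  exact sub_nonneg.2 (le_trans (csInf_le hK.bddBelow hy) (le_csSup hK.bddAbove hy))

/-- **NF-4ᵛ BY NAME: `OneSidedNetFluxLaw → OscLeVorticity → NearCentreFlux → NetFluxWindowDecay`.** -/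
theorem netFluxWindowDecay_of_laws (hL : OneSidedNetFluxLaw) (hO : OscLeVorticity) (hNC : NearCentreFlux) :
    NetFluxWindowDecay := by
  intro C hC
  obtain ⟨lam, hlam, A, hOU⟩ := HalfLineOU.halfLineOU_decay_viscosity C hC
  refine ⟨lam, hlam, A * (Real.pi / 2), ?_⟩
  intro v x₀ T C₁ t₀ ht₀ hv hT hvC hωC hlink hlaw huni t₁ t R ht₁ ht₁t ht hR
  -- time slices of the data
  have hvs : ∀ t' ∈ Ioo t₀ 0, ContDiff ℝ 1 (v t') := fun t' ht' => by
    have h : ContDiffOn ℝ (⊤ : ℕ∞) (uncurry v ∘ fun x : E3 => (t', x)) univ :=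
      hv.comp ((contDiff_prodMk_right t').contDiffOn (s := univ)) (fun x _ => ⟨ht', mem_univ x⟩)
    have h2 : ContDiff ℝ (⊤ : ℕ∞) (v t') := contDiffOn_univ.1 h
    exact h2.of_le (by exact_mod_cast le_top)
  have hTs : ∀ t' ∈ Ioo t₀ 0, ContDiffOn ℝ 1 (T t') ({x₀}ᶜ : Set E3) := fun t' ht' => by
    have h : ContDiffOn ℝ (⊤ : ℕ∞) (uncurry T ∘ fun x : E3 => (t', x)) ({x₀}ᶜ : Set E3) :=
      hT.comp ((contDiff_prodMk_right t').contDiffOn (s := ({x₀}ᶜ : Set E3))) (fun x hx => ⟨ht', hx⟩)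
    exact h.of_le (by exact_mod_cast le_top)
  -- `0 ≤ C₁`
  have ht₁mem : t₁ ∈ Ioo t₀ 0 := ⟨ht₁, lt_of_le_of_lt ht₁t ht⟩
  have hC₁ : 0 ≤ C₁ := by
    have h0 : (0:ℝ) ≤ C₁ / (-t₁) := le_trans (norm_nonneg _) (hωC t₁ ht₁mem x₀)
    have hnt : 0 < -t₁ := by linarith [ht₁mem.2]
    by_contra hneg
    push Not at hneg
    have : C₁ / (-t₁) < 0 := div_neg_of_neg_of_pos hneg hnt
    linarith
  -- (1) the a-priori bound on the net flux density
  have hbd : ∀ t' ∈ Ioo t₀ 0, ∀ r, 0 < r →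
      0 ≤ netFlux (T t') x₀ r ∧ netFlux (T t') x₀ r ≤ Real.pi * C₁ * r / (-t') := by
    intro t' ht' r hr
    have hnt : 0 < -t' := by linarith [ht'.2]
    have hosc : sphOsc (T t') x₀ r ≤ Real.pi * (C₁ / (-t')) :=
      hO (v t') x₀ (T t') r (C₁ / (-t')) hr (hvs t' ht') (hTs t' ht') (hlink t' ht') (fun x _ => hωC t' ht' x)
    have hosc0 : 0 ≤ sphOsc (T t') x₀ r := sphOsc_nonneg_offCentre (hTs t' ht').continuousOn hr
    refine ⟨mul_nonneg hr.le hosc0, ?_⟩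
    calc netFlux (T t') x₀ r = r * sphOsc (T t') x₀ r := rfl
      _ ≤ r * (Real.pi * (C₁ / (-t'))) := mul_le_mul_of_nonneg_left hosc hr.le
      _ = Real.pi * C₁ * r / (-t') := by field_simp
  -- (L) and (NC) for these data
  obtain ⟨ℓp, ℓm, hcont, hℓp, hℓm, hlawL⟩ := hL v x₀ T (fun s => C / Real.sqrt (-s)) t₀ hv hT hvC hlaw huni
  have hnc : ∀ t₁' t₂' : ℝ, t₀ < t₁' → t₁' ≤ t₂' → t₂' < 0 → ∃ κ : ℝ, 0 ≤ κ ∧ ∀ a₀ : ℝ, 0 < a₀ → a₀ ≤ 1 →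
      (∀ t' ∈ Icc t₁' t₂', (∀ a ∈ Ioo 0 a₀, netFlux (T t') x₀ a ≤ κ * a ^ 2) ∧
        LipschitzOnWith (Real.toNNReal (κ * a₀)) (fun r => netFlux (T t') x₀ r) (Ioo 0 a₀)) ∧
      (∀ t' ∈ Icc t₁' t₂', ∀ t'' ∈ Icc t₁' t₂', ∀ a ∈ Ioo 0 a₀,
        |netFlux (T t') x₀ a - netFlux (T t'') x₀ a| ≤ κ * a ^ 2 * |t' - t''|) :=
    fun t₁' t₂' h1 h2 h3 => hNC v x₀ T t₀ t₁' t₂' h1 h2 h3 hv hT hlink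
  -- (2) the self-similar cumulative flux `U`
  set s₁ : ℝ := -Real.log (-t₁) with hs₁
  have hnt₁ : 0 < -t₁ := by linarith [ht₁mem.2]
  have hτs₁ : -Real.exp (-s₁) = t₁ := by rw [hs₁, neg_neg, Real.exp_log hnt₁, neg_neg]
  have hτ : ∀ s, s₁ ≤ s → -Real.exp (-s) ∈ Ioo t₀ 0 := fun s hs => by
    refine ⟨?_, neg_neg_of_pos (Real.exp_pos _)⟩
    have h1 : Real.exp (-s) ≤ Real.exp (-s₁) := Real.exp_le_exp.2 (by linarith)
    linarith [hτs₁]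
  obtain ⟨U, hU⟩ : ∃ U : ℝ → ℝ → ℝ, ∀ s ρ,
      U s ρ = ∫ r in (0:ℝ)..(ρ * Real.exp (-s / 2)), netFlux (T (-Real.exp (-s))) x₀ r :=
    ⟨fun s ρ => ∫ r in (0:ℝ)..(ρ * Real.exp (-s / 2)), netFlux (T (-Real.exp (-s))) x₀ r, fun _ _ => rfl⟩
  have hW := continuousOn_window_primitive (w := fun t' r => netFlux (T t') x₀ r) (t₀ := t₀) (K := Real.pi * C₁)
    hcont hbd
  have hUcont : ContinuousOn (uncurry U) (Ici s₁ ×ˢ Ici 0) := by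
    have hmap : Continuous (fun q : ℝ × ℝ => ((-Real.exp (-q.1), q.2 * Real.exp (-q.1 / 2)) : ℝ × ℝ)) := by
      fun_prop
    have hmaps : MapsTo (fun q : ℝ × ℝ => ((-Real.exp (-q.1), q.2 * Real.exp (-q.1 / 2)) : ℝ × ℝ))
        (Ici s₁ ×ˢ Ici 0) (Ioo t₀ 0 ×ˢ Ici 0) :=
      fun q hq => ⟨hτ q.1 hq.1, mul_nonneg hq.2 (Real.exp_pos _).le⟩
    have hcomp := hW.comp hmap.continuousOn hmaps
    have heq : uncurry U = (fun p : ℝ × ℝ => ∫ r in (0:ℝ)..p.2, netFlux (T p.1) x₀ r) ∘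
        (fun q : ℝ × ℝ => ((-Real.exp (-q.1), q.2 * Real.exp (-q.1 / 2)) : ℝ × ℝ)) := by
      funext q
      simp only [Function.comp_apply, Function.uncurry_def]
      rw [hU]
    rw [heq]
    exact hcomp
  have hU0 : ∀ s, s₁ ≤ s → U s 0 ≤ 0 := fun s _ => by rw [hU]; simp
  have hUgr : ∀ s, s₁ ≤ s → ∀ ρ, 0 ≤ ρ → U s ρ ≤ Real.pi / 2 * C₁ * (1 + ρ) ^ 3 := by
    intro s hs ρ hρ
    rw [hU]
    have hb := window_primitive_le (w := fun t' r => netFlux (T t') x₀ r) (t₀ := t₀) (K := Real.pi * C₁)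
      hcont hbd (hτ s hs) (R := ρ * Real.exp (-s / 2)) (mul_nonneg hρ (Real.exp_pos _).le)
    have he : Real.exp (-s / 2) ^ 2 = Real.exp (-s) := by rw [sq, ← Real.exp_add]; ring_nf
    have hval : Real.pi * C₁ / -(-Real.exp (-s)) * (ρ * Real.exp (-s / 2)) ^ 2 / 2
        = Real.pi / 2 * C₁ * ρ ^ 2 := by
      rw [neg_neg, mul_pow, he]; field_simp
    have hρ3 : ρ ^ 2 ≤ (1 + ρ) ^ 3 := by
      have h3 : 0 ≤ ρ ^ 3 := pow_nonneg hρ 3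
      nlinarith [sq_nonneg ρ]
    calc ∫ r in (0:ℝ)..(ρ * Real.exp (-s / 2)), netFlux (T (-Real.exp (-s))) x₀ r
        ≤ Real.pi / 2 * C₁ * ρ ^ 2 := hval ▸ hb
      _ ≤ Real.pi / 2 * C₁ * (1 + ρ) ^ 3 := mul_le_mul_of_nonneg_left hρ3 (by positivity)
  -- (3) the viscosity inequality and (4) the OU decay BY NAME
  have key := hOU U s₁ (Real.pi / 2 * C₁) hUcont hU0 hUgr (by positivity)
    (fun φ φₛ φ₁ φ₂ s₀ ρ₀ hs₀ hρ₀ hφs hφ1 hφ2 hmax =>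
      viscosity_inequality_window (w := fun t' r => netFlux (T t') x₀ r) hC hcont hbd hℓp hℓm hlawL hnc hU
        φ φₛ φ₁ φ₂ s₀ ρ₀ (hτ s₀ hs₀.le).1 hρ₀ hφs hφ1 hφ2 hmax)
  -- back to `(t, R)`
  have hnt : 0 < -t := by linarith
  set s : ℝ := -Real.log (-t) with hs
  have hss₁ : s₁ ≤ s := by
    rw [hs, hs₁]
    have := Real.log_le_log hnt (by linarith : -t ≤ -t₁)
    linarith
  have hτs : -Real.exp (-s) = t := by rw [hs, neg_neg, Real.exp_log hnt, neg_neg]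
  have hsq : Real.exp (-s / 2) = Real.sqrt (-t) := by
    rw [hs, neg_neg, Real.sqrt_eq_rpow, Real.rpow_def_of_pos hnt]
    congr 1; ring
  have hsqpos : 0 < Real.sqrt (-t) := Real.sqrt_pos.2 hnt
  have hρR : R / Real.sqrt (-t) * Real.exp (-s / 2) = R := by
    rw [hsq]; field_simp
  have hfin := key s hss₁ (R / Real.sqrt (-t)) (div_nonneg hR.le hsqpos.le)
  rw [hU, hρR, hτs] at hfin
  have hexp : Real.exp (-lam * (s - s₁)) = (t / t₁) ^ lam := by
    have hq : 0 < t / t₁ := div_pos_of_neg_of_neg ht (by linarith)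
    rw [Real.rpow_def_of_pos hq, hs, hs₁]
    congr 1
    have : Real.log (t / t₁) = Real.log (-t) - Real.log (-t₁) := by
      rw [← Real.log_div hnt.ne' hnt₁.ne', neg_div_neg_eq]
    rw [this]; ring
  rw [hexp] at hfin
  rw [setIntegral_Ioo_eq_intervalIntegral _ hR.le]
  calc ∫ r in (0:ℝ)..R, netFlux (T t) x₀ r
      ≤ A * (Real.pi / 2 * C₁) * (1 + R / Real.sqrt (-t)) ^ 3 * (t / t₁) ^ lam := hfin
    _ = A * (Real.pi / 2) * C₁ * (1 + R / Real.sqrt (-t)) ^ 3 * (t / t₁) ^ lam := by ring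

end Summit.NavierStokesRegularity.NavierStokesRegularity.Theorems.PoloidalLiouville.NetFlux

end
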